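import Literature.AlgebraicGeometry.Frobenioids.EquivalenceGroupLikeDegrees
import Literature.AlgebraicGeometry.Frobenioids.EquivalenceFrobeniusQuasiIsotropic
import HarnessLib

/-!
# Frobenioids I, §3: Theorem 3.4 (iii) for Frobenioids of GROUP-LIKE type — quasi-isotropic type and the
# typed shape `PreFrobenioidData.Thm34iii`

Mochizuki, *The geometry of Frobenioids I: the general theory*, Kyushu J. Math. **62** (2008),
Thm. 3.4 (iii), statement kurims p. 62, proof pp. 64–65 [cite: MochizukiFrdI2008, Thm. 3.4 (iii) p.62].

PROOF-ONLY sequel of `EquivalenceGroupLikeType.lean` (abc-iut-L1-t11) and `EquivalenceGroupLikeDegrees.lean`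
(abc-iut-w4-d088) (abc-iut cell, WAVE-4 discharge; sub-node
`FrdI:Thm3.4(iii)/L01g` of `plan/L1/SUBDAG-FrdI-Thm34.md`). The isotropic-type core of that file
(`FrdI.exists_degreeAut_of_groupLikeType`: an automorphism `Ψ^{ℕ≥1}` of `ℕ≥1` with
`deg_Fr(Ψ φ) = Ψ^{ℕ≥1}(deg_Fr φ)` for every arrow, for Frobenioids of isotropic and group-like type and an
equivalence `Ψ` with `Ψ`, `Ψ⁻¹` preserving base-isomorphisms) is upgraded here to QUASI-ISOTROPIC type
(standard type (a)) through `Ψ^istr : C₁^istr ≌ C₂^istr` (Thm. 3.4 (i)) and isotropic hulls — "since the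
isotropification functor preserves Frobenius degrees" (p. 64) — exactly as in the sibling file
`EquivalenceFrobeniusQuasiIsotropic.lean` (abc-iut-L1-t13) for the non-group-like case; then the seven
classes of Thm. 3.4 (iii) are preserved: linear morphisms (`Ψ^{ℕ≥1}(1) = 1`), base-isomorphisms
(hypothesis (b)), pull-back morphisms (Prop. 1.7 (ii), `Ψ⁻¹` preserves base-isomorphisms), isometries
(every arrow of a Frobenioid of group-like type is one), co-angular morphisms (test factorisations pulled
back along `Ψ⁻¹`, which preserves linear morphisms, isometric pre-steps and base-isomorphisms),
LB-invertible morphisms and morphisms of Frobenius type. Finally the result is packaged in the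
vocabulary of the §3 statement files (`PreFrobenioidData.ofFunctor`): (1) with the conclusion VERBATIM
that of the typed `PreFrobenioidData.Thm34iii` (its clause "`Ψ^{ℕ≥1} = id` if `C₁`, `C₂` admit a
non-group-like object" is vacuous in group-like type), and (2) in the literal shape of the sub-DAG slot
`FrdI.Thm34Sub.L01g_GroupLikeTypeCase` (abc-iut-L1-d8, `Thm34Sub.lean`; its FSM-type hypotheses are
accepted and not used), so that the slot's `_holds` is a one-line application. No FSMFF/FSM-type or
non-dilating hypothesis is used. No statement of the paper is restated or strengthened; nothing here bears on [IUTchIII] Cor. 3.12.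
-/

set_option backward.isDefEq.respectTransparency false

namespace Literature.AlgebraicGeometry.Frobenioids

open CategoryTheory Opposite

universe w v v' u u'

namespace FrdI

section Two

variable {D₁ : Type u} [Category.{v} D₁] {Φ₁ : D₁ᵒᵖ ⥤ CommMonCat.{w}} {C₁ : Type u'}
  [Category.{v'} C₁] {D₂ : Type u} [Category.{v} D₂] {Φ₂ : D₂ᵒᵖ ⥤ CommMonCat.{w}} {C₂ : Type u'}
  [Category.{v'} C₂] {F₁ : C₁ ⥤ ElemFrobenioid Φ₁} {F₂ : C₂ ⥤ ElemFrobenioid Φ₂}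

/-! ### Quasi-isotropic and group-like type: through `Ψ^istr` and isotropic hulls -/

/-- Group-likeness of `C` passes to `C^istr` (same base objects). [cite: MochizukiFrdI2008, Def. 1.2 (iv) p.23] -/
theorem isGroupLikeObj_istr {D : Type u} [Category.{v} D] {Φ : Dᵒᵖ ⥤ CommMonCat.{w}} {C : Type u'}
    [Category.{v'} C] {F : C ⥤ ElemFrobenioid Φ} (hg : ∀ A : C, PreFrobenioid.IsGroupLikeObj F A)
    (X : PreFrobenioid.Istr F) : PreFrobenioid.IsGroupLikeObj (PreFrobenioid.istrFunctor F) X :=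
  hg X.obj

/-- **`deg_Fr(Ψ φ) = Ψ^{ℕ≥1}(deg_Fr φ)` for every arrow — quasi-isotropic and group-like type**, `Ψ` and
`Ψ⁻¹` preserving base-isomorphisms ("since the isotropification functor preserves Frobenius degrees":
through `Ψ^istr : C₁^istr ≌ C₂^istr` of Thm. 3.4 (i) and isotropic hulls, whose images are isometric
pre-steps, Prop. 1.9 (vii)). [cite: MochizukiFrdI2008, Thm. 3.4 (iii) p.64] -/
theorem exists_degreeAut_of_groupLikeType_quasiIsotropic (hF₁ : PreFrobenioid.IsFrobenioid F₁)
    (hF₂ : PreFrobenioid.IsFrobenioid F₂) (hq₁ : (PreFrobenioidData.ofFunctor Φ₁ F₁).IsOfQuasiIsotropicType)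
    (hq₂ : (PreFrobenioidData.ofFunctor Φ₂ F₂).IsOfQuasiIsotropicType)
    (hg₁ : ∀ A : C₁, PreFrobenioid.IsGroupLikeObj F₁ A) (hg₂ : ∀ A : C₂, PreFrobenioid.IsGroupLikeObj F₂ A)
    (Ψ : C₁ ≌ C₂)
    (hB : ∀ ⦃A B : C₁⦄ (φ : A ⟶ B), PreFrobenioid.IsBaseIso F₁ φ → PreFrobenioid.IsBaseIso F₂ (Ψ.functor.map φ))
    (hB' : ∀ ⦃A B : C₂⦄ (φ : A ⟶ B), PreFrobenioid.IsBaseIso F₂ φ → PreFrobenioid.IsBaseIso F₁ (Ψ.inverse.map φ)) :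
    ∃ ΨN : ℕ+ ≃* ℕ+, ∀ ⦃A B : C₁⦄ (φ : A ⟶ B),
      PreFrobenioid.degFr F₂ (Ψ.functor.map φ) = ΨN (PreFrobenioid.degFr F₁ φ) := by
  have hP₂ := hF₂.isPreFrobenioid
  -- `Ψ^istr`
  haveI : (PreFrobenioid.isotropicObjects F₂).IsClosedUnderIsomorphisms :=
    ⟨fun e hX => PreFrobenioid.IsIsotropic.of_iso hP₂ e.symm hX⟩
  let Ψi : PreFrobenioid.Istr F₁ ≌ PreFrobenioid.Istr F₂ :=
    Ψ.congrFullSubcategory (isotropicObjects_inverseImage hF₁ hq₁ hq₂ Ψ)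
  obtain ⟨ΨN, hΨN⟩ := exists_degreeAut_of_groupLikeType (PreFrobenioid.isFrobenioid_istr hF₁)
    (PreFrobenioid.isFrobenioid_istr hF₂) (fun X => PreFrobenioid.isIsotropic_istr X)
    (fun X => PreFrobenioid.isIsotropic_istr X) (isGroupLikeObj_istr hg₁) (isGroupLikeObj_istr hg₂) Ψi
    (fun X Y f hf => hB f.hom hf) (fun X Y f hf => hB' f.hom hf)
  refine ⟨ΨN, fun A B φ => ?_⟩
  -- hulls and the induced arrow `φ'` between them
  obtain ⟨A', hA, hhA⟩ := hF₁.vii_a A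
  obtain ⟨B', hB₀, hhB⟩ := hF₁.vii_a B
  obtain ⟨hiA, hpA, hA'i, hunivA⟩ := id hhA
  obtain ⟨hiB, hpB, hB'i, -⟩ := id hhB
  obtain ⟨φ', hφ', -⟩ := hunivA (φ ≫ hB₀) hB'i
  have hdφ' : PreFrobenioid.degFr F₁ φ' = PreFrobenioid.degFr F₁ φ := by
    have := congrArg (PreFrobenioid.degFr F₁) hφ'
    rw [PreFrobenioid.degFr_comp, PreFrobenioid.degFr_comp, show PreFrobenioid.degFr F₁ hA = 1 from hpA.1,
      show PreFrobenioid.degFr F₁ hB₀ = 1 from hpB.1, one_mul, mul_one] at this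
    exact this
  -- the isotropic core on `Ψ^istr`
  let a : PreFrobenioid.Istr F₁ := ⟨A', hA'i⟩
  let b : PreFrobenioid.Istr F₁ := ⟨B', hB'i⟩
  let f : a ⟶ b := ObjectProperty.homMk φ'
  have hΨφ' : PreFrobenioid.degFr F₂ (Ψ.functor.map φ') = ΨN (PreFrobenioid.degFr F₁ φ') := hΨN f
  -- transfer along the hulls
  have hΨhA := (isIsometry_isPreStep_map hF₁ hF₂ hq₁ hq₂ Ψ hiA hpA).2
  have hΨhB := (isIsometry_isPreStep_map hF₁ hF₂ hq₁ hq₂ Ψ hiB hpB).2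
  have := congrArg (fun g => PreFrobenioid.degFr F₂ (Ψ.functor.map g)) hφ'
  simp only [Functor.map_comp, PreFrobenioid.degFr_comp] at this
  rw [show PreFrobenioid.degFr F₂ (Ψ.functor.map hA) = 1 from hΨhA.1,
    show PreFrobenioid.degFr F₂ (Ψ.functor.map hB₀) = 1 from hΨhB.1, one_mul, mul_one, hΨφ', hdφ'] at this
  exact this.symm

/-- **Thm. 3.4 (iii), group-like case: `Ψ` preserves linear morphisms** (quasi-isotropic type).
[cite: MochizukiFrdI2008, Thm. 3.4 (iii) p.64] -/
theorem isLinear_map_of_groupLikeType_quasiIsotropic (hF₁ : PreFrobenioid.IsFrobenioid F₁)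
    (hF₂ : PreFrobenioid.IsFrobenioid F₂) (hq₁ : (PreFrobenioidData.ofFunctor Φ₁ F₁).IsOfQuasiIsotropicType)
    (hq₂ : (PreFrobenioidData.ofFunctor Φ₂ F₂).IsOfQuasiIsotropicType)
    (hg₁ : ∀ A : C₁, PreFrobenioid.IsGroupLikeObj F₁ A) (hg₂ : ∀ A : C₂, PreFrobenioid.IsGroupLikeObj F₂ A)
    (Ψ : C₁ ≌ C₂)
    (hB : ∀ ⦃A B : C₁⦄ (φ : A ⟶ B), PreFrobenioid.IsBaseIso F₁ φ → PreFrobenioid.IsBaseIso F₂ (Ψ.functor.map φ))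
    (hB' : ∀ ⦃A B : C₂⦄ (φ : A ⟶ B), PreFrobenioid.IsBaseIso F₂ φ → PreFrobenioid.IsBaseIso F₁ (Ψ.inverse.map φ))
    {A B : C₁} {φ : A ⟶ B} (hφ : PreFrobenioid.IsLinear F₁ φ) : PreFrobenioid.IsLinear F₂ (Ψ.functor.map φ) := by
  obtain ⟨ΨN, hΨN⟩ := exists_degreeAut_of_groupLikeType_quasiIsotropic hF₁ hF₂ hq₁ hq₂ hg₁ hg₂ Ψ hB hB'
  change PreFrobenioid.degFr F₂ (Ψ.functor.map φ) = 1
  rw [hΨN φ, show PreFrobenioid.degFr F₁ φ = 1 from hφ, map_one]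

/-- **Thm. 3.4 (iii), group-like case: `Ψ` preserves co-angular morphisms** (quasi-isotropic type; the
test factorisations in `C₂` pull back along `Ψ⁻¹`, which preserves linear morphisms, isometric
pre-steps and base-isomorphisms). [cite: MochizukiFrdI2008, Thm. 3.4 (iii) p.64] -/
theorem isCoAngular_map_of_groupLikeType_quasiIsotropic (hF₁ : PreFrobenioid.IsFrobenioid F₁)
    (hF₂ : PreFrobenioid.IsFrobenioid F₂) (hq₁ : (PreFrobenioidData.ofFunctor Φ₁ F₁).IsOfQuasiIsotropicType)
    (hq₂ : (PreFrobenioidData.ofFunctor Φ₂ F₂).IsOfQuasiIsotropicType)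
    (hg₁ : ∀ A : C₁, PreFrobenioid.IsGroupLikeObj F₁ A) (hg₂ : ∀ A : C₂, PreFrobenioid.IsGroupLikeObj F₂ A)
    (Ψ : C₁ ≌ C₂)
    (hB : ∀ ⦃A B : C₁⦄ (φ : A ⟶ B), PreFrobenioid.IsBaseIso F₁ φ → PreFrobenioid.IsBaseIso F₂ (Ψ.functor.map φ))
    (hB' : ∀ ⦃A B : C₂⦄ (φ : A ⟶ B), PreFrobenioid.IsBaseIso F₂ φ → PreFrobenioid.IsBaseIso F₁ (Ψ.inverse.map φ))
    {A B : C₁} {φ : A ⟶ B} (hφ : PreFrobenioid.IsCoAngular F₁ φ) :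
    PreFrobenioid.IsCoAngular F₂ (Ψ.functor.map φ) := by
  intro X' Y' γ' β' α' hfac hα' hβ'i hβ'p hbi
  -- pull the factorisation back to `C₁`
  have key : Ψ.unit.app A ≫ Ψ.inverse.map γ' ≫ Ψ.inverse.map β' ≫ Ψ.inverse.map α' ≫ Ψ.unitInv.app B = φ := by
    rw [← Ψ.inverse.map_comp_assoc, ← Ψ.inverse.map_comp_assoc, Category.assoc, hfac, Ψ.inv_fun_map]
    simp
  have hfac₁ : (Ψ.unit.app A ≫ Ψ.inverse.map γ') ≫ Ψ.inverse.map β' ≫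
      (Ψ.inverse.map α' ≫ Ψ.unitInv.app B) = φ := by
    simpa only [Category.assoc] using key
  have hB'' : ∀ ⦃A B : C₁⦄ (φ : A ⟶ B), PreFrobenioid.IsBaseIso F₁ φ →
      PreFrobenioid.IsBaseIso F₂ (Ψ.symm.inverse.map φ) := hB
  have hα₁ : PreFrobenioid.IsLinear F₁ (Ψ.inverse.map α' ≫ Ψ.unitInv.app B) :=
    PreFrobenioid.IsLinear.comp F₁
      (isLinear_map_of_groupLikeType_quasiIsotropic hF₂ hF₁ hq₂ hq₁ hg₂ hg₁ Ψ.symm hB' hB'' hα')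
      (PreFrobenioid.isLinear_of_isIso F₁ _)
  obtain ⟨hβ₁i, hβ₁p⟩ := isIsometry_isPreStep_map hF₂ hF₁ hq₂ hq₁ Ψ.symm hβ'i hβ'p
  have hbi₁ : PreFrobenioid.IsBaseIso F₁ (Ψ.inverse.map α' ≫ Ψ.unitInv.app B) ∨
      PreFrobenioid.IsBaseIso F₁ (Ψ.unit.app A ≫ Ψ.inverse.map γ') := by
    rcases hbi with h | h
    · exact Or.inl (PreFrobenioid.IsBaseIso.comp F₁ (hB' _ h) (PreFrobenioid.isBaseIso_of_isIso F₁ _))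
    · exact Or.inr (PreFrobenioid.IsBaseIso.comp F₁ (PreFrobenioid.isBaseIso_of_isIso F₁ _) (hB' _ h))
  haveI := hφ _ _ _ hfac₁ hα₁ hβ₁i hβ₁p hbi₁
  exact isIso_of_fully_faithful Ψ.inverse β'

/-- **Thm. 3.4 (iii), group-like case: `Ψ` preserves LB-invertible morphisms** (quasi-isotropic type).
[cite: MochizukiFrdI2008, Thm. 3.4 (iii) p.64] -/
theorem isLBInvertible_map_of_groupLikeType_quasiIsotropic (hF₁ : PreFrobenioid.IsFrobenioid F₁)
    (hF₂ : PreFrobenioid.IsFrobenioid F₂) (hq₁ : (PreFrobenioidData.ofFunctor Φ₁ F₁).IsOfQuasiIsotropicType)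
    (hq₂ : (PreFrobenioidData.ofFunctor Φ₂ F₂).IsOfQuasiIsotropicType)
    (hg₁ : ∀ A : C₁, PreFrobenioid.IsGroupLikeObj F₁ A) (hg₂ : ∀ A : C₂, PreFrobenioid.IsGroupLikeObj F₂ A)
    (Ψ : C₁ ≌ C₂)
    (hB : ∀ ⦃A B : C₁⦄ (φ : A ⟶ B), PreFrobenioid.IsBaseIso F₁ φ → PreFrobenioid.IsBaseIso F₂ (Ψ.functor.map φ))
    (hB' : ∀ ⦃A B : C₂⦄ (φ : A ⟶ B), PreFrobenioid.IsBaseIso F₂ φ → PreFrobenioid.IsBaseIso F₁ (Ψ.inverse.map φ))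
    {A B : C₁} {φ : A ⟶ B} (hφ : PreFrobenioid.IsLBInvertible F₁ φ) :
    PreFrobenioid.IsLBInvertible F₂ (Ψ.functor.map φ) :=
  ⟨isCoAngular_map_of_groupLikeType_quasiIsotropic hF₁ hF₂ hq₁ hq₂ hg₁ hg₂ Ψ hB hB' hφ.1, isIsometry_map_of_groupLikeType hg₂ Ψ φ⟩

/-- **Thm. 3.4 (iii), group-like case: `Ψ` preserves morphisms of Frobenius type** (quasi-isotropic
type: LB-invertible base-isomorphisms, hypothesis (b)). [cite: MochizukiFrdI2008, Thm. 3.4 (iii) p.64] -/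
theorem isFrobeniusType_map_of_groupLikeType_quasiIsotropic (hF₁ : PreFrobenioid.IsFrobenioid F₁)
    (hF₂ : PreFrobenioid.IsFrobenioid F₂) (hq₁ : (PreFrobenioidData.ofFunctor Φ₁ F₁).IsOfQuasiIsotropicType)
    (hq₂ : (PreFrobenioidData.ofFunctor Φ₂ F₂).IsOfQuasiIsotropicType)
    (hg₁ : ∀ A : C₁, PreFrobenioid.IsGroupLikeObj F₁ A) (hg₂ : ∀ A : C₂, PreFrobenioid.IsGroupLikeObj F₂ A)
    (Ψ : C₁ ≌ C₂)
    (hB : ∀ ⦃A B : C₁⦄ (φ : A ⟶ B), PreFrobenioid.IsBaseIso F₁ φ → PreFrobenioid.IsBaseIso F₂ (Ψ.functor.map φ))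
    (hB' : ∀ ⦃A B : C₂⦄ (φ : A ⟶ B), PreFrobenioid.IsBaseIso F₂ φ → PreFrobenioid.IsBaseIso F₁ (Ψ.inverse.map φ))
    {A B : C₁} {φ : A ⟶ B} (hφ : PreFrobenioid.IsFrobeniusType F₁ φ) :
    PreFrobenioid.IsFrobeniusType F₂ (Ψ.functor.map φ) :=
  ⟨isLBInvertible_map_of_groupLikeType_quasiIsotropic hF₁ hF₂ hq₁ hq₂ hg₁ hg₂ Ψ hB hB' hφ.1, hB φ hφ.2⟩

/-! ### Packaging in the vocabulary of the §3 statement files (`PreFrobenioidData.ofFunctor`) -/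

/-- **Thm. 3.4 (iii), GROUP-LIKE-TYPE case, in the shape of the typed statement
`PreFrobenioidData.Thm34iii`**: for Frobenioids `C₁`, `C₂` of quasi-isotropic type (standard type (a))
and of group-like type, and an equivalence `Ψ` such that `Ψ` and `Ψ⁻¹` preserve base-isomorphisms
(hypothesis (b)), `Ψ` preserves morphisms of Frobenius type, linear morphisms, base-isomorphisms,
co-angular morphisms, pull-back morphisms, isometries and LB-invertible morphisms, and there is an
automorphism `Ψ^{ℕ≥1}` of `ℕ≥1` with `deg_Fr(Ψ φ) = Ψ^{ℕ≥1}(deg_Fr φ)` for every `φ` (the clause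
"`Ψ^{ℕ≥1} = id` if `C₁`, `C₂` admit a non-group-like object" is vacuous here and kept verbatim).
[cite: MochizukiFrdI2008, Thm. 3.4 (iii) p.62] -/
theorem thm34iii_morphisms_of_isOfGroupLikeType (hF₁ : PreFrobenioid.IsFrobenioid F₁)
    (hF₂ : PreFrobenioid.IsFrobenioid F₂) (hq₁ : (PreFrobenioidData.ofFunctor Φ₁ F₁).IsOfQuasiIsotropicType)
    (hq₂ : (PreFrobenioidData.ofFunctor Φ₂ F₂).IsOfQuasiIsotropicType)
    (hg₁ : (PreFrobenioidData.ofFunctor Φ₁ F₁).IsOfGroupLikeType)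
    (hg₂ : (PreFrobenioidData.ofFunctor Φ₂ F₂).IsOfGroupLikeType) (Ψ : C₁ ≌ C₂)
    (hB : PreFrobenioidData.PreservesMor Ψ.functor (PreFrobenioidData.ofFunctor Φ₁ F₁).IsBaseIso
      (PreFrobenioidData.ofFunctor Φ₂ F₂).IsBaseIso)
    (hB' : PreFrobenioidData.PreservesMor Ψ.inverse (PreFrobenioidData.ofFunctor Φ₂ F₂).IsBaseIso
      (PreFrobenioidData.ofFunctor Φ₁ F₁).IsBaseIso) :
    (PreFrobenioidData.PreservesMor Ψ.functor (PreFrobenioidData.ofFunctor Φ₁ F₁).IsFrobeniusType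
        (PreFrobenioidData.ofFunctor Φ₂ F₂).IsFrobeniusType ∧
      PreFrobenioidData.PreservesMor Ψ.functor (PreFrobenioidData.ofFunctor Φ₁ F₁).IsLinear
        (PreFrobenioidData.ofFunctor Φ₂ F₂).IsLinear ∧
      PreFrobenioidData.PreservesMor Ψ.functor (PreFrobenioidData.ofFunctor Φ₁ F₁).IsBaseIso
        (PreFrobenioidData.ofFunctor Φ₂ F₂).IsBaseIso ∧
      PreFrobenioidData.PreservesMor Ψ.functor (PreFrobenioidData.ofFunctor Φ₁ F₁).IsCoAngular
        (PreFrobenioidData.ofFunctor Φ₂ F₂).IsCoAngular ∧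
      PreFrobenioidData.PreservesMor Ψ.functor (PreFrobenioidData.ofFunctor Φ₁ F₁).IsPullbackMorphism
        (PreFrobenioidData.ofFunctor Φ₂ F₂).IsPullbackMorphism ∧
      PreFrobenioidData.PreservesMor Ψ.functor (PreFrobenioidData.ofFunctor Φ₁ F₁).IsIsometry
        (PreFrobenioidData.ofFunctor Φ₂ F₂).IsIsometry ∧
      PreFrobenioidData.PreservesMor Ψ.functor (PreFrobenioidData.ofFunctor Φ₁ F₁).IsLBInvertible
        (PreFrobenioidData.ofFunctor Φ₂ F₂).IsLBInvertible) ∧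
    ∃ ΨN : ℕ+ ≃* ℕ+, (∀ ⦃A B : C₁⦄ (φ : A ⟶ B),
        (PreFrobenioidData.ofFunctor Φ₂ F₂).degFr (Ψ.functor.map φ) =
          ΨN ((PreFrobenioidData.ofFunctor Φ₁ F₁).degFr φ)) ∧
      ((∃ A : C₁, ¬ (PreFrobenioidData.ofFunctor Φ₁ F₁).IsGroupLikeObj A) →
        (∃ A : C₂, ¬ (PreFrobenioidData.ofFunctor Φ₂ F₂).IsGroupLikeObj A) → ΨN = MulEquiv.refl ℕ+) := by
  have hg₁' : ∀ A : C₁, PreFrobenioid.IsGroupLikeObj F₁ A := fun A => hg₁.obj A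
  have hg₂' : ∀ A : C₂, PreFrobenioid.IsGroupLikeObj F₂ A := fun A => hg₂.obj A
  have hb : ∀ ⦃A B : C₁⦄ (φ : A ⟶ B), PreFrobenioid.IsBaseIso F₁ φ →
      PreFrobenioid.IsBaseIso F₂ (Ψ.functor.map φ) := hB
  have hb' : ∀ ⦃A B : C₂⦄ (φ : A ⟶ B), PreFrobenioid.IsBaseIso F₂ φ →
      PreFrobenioid.IsBaseIso F₁ (Ψ.inverse.map φ) := hB'
  obtain ⟨ΨN, hΨN⟩ := exists_degreeAut_of_groupLikeType_quasiIsotropic hF₁ hF₂ hq₁ hq₂ hg₁' hg₂' Ψ hb hb'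
  refine ⟨⟨fun A B φ hφ => ?_, fun A B φ hφ => ?_, hB, fun A B φ hφ => ?_, fun A B φ hφ => ?_,
    fun A B φ _ => ?_, fun A B φ hφ => ?_⟩, ΨN, hΨN, fun hN₁ _ => ?_⟩
  · rw [PreFrobenioidData.ofFunctor_isFrobeniusType] at hφ ⊢
    exact isFrobeniusType_map_of_groupLikeType_quasiIsotropic hF₁ hF₂ hq₁ hq₂ hg₁' hg₂' Ψ hb hb' hφ
  · exact isLinear_map_of_groupLikeType_quasiIsotropic hF₁ hF₂ hq₁ hq₂ hg₁' hg₂' Ψ hb hb' hφ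
  · rw [PreFrobenioidData.ofFunctor_isCoAngular] at hφ ⊢
    exact isCoAngular_map_of_groupLikeType_quasiIsotropic hF₁ hF₂ hq₁ hq₂ hg₁' hg₂' Ψ hb hb' hφ
  · rw [PreFrobenioidData.ofFunctor_isPullbackMorphism] at hφ ⊢
    exact isPullbackMorphism_map_of_groupLikeType hF₁ hF₂ Ψ hb' hφ
  · exact isIsometry_map_of_groupLikeType hg₂' Ψ φ
  · rw [PreFrobenioidData.ofFunctor_isLBInvertible] at hφ ⊢
    exact isLBInvertible_map_of_groupLikeType_quasiIsotropic hF₁ hF₂ hq₁ hq₂ hg₁' hg₂' Ψ hb hb' hφ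
  · obtain ⟨A, hA⟩ := hN₁
    exact (hA (hg₁.obj A)).elim

/-- **Thm. 3.4 (iii), GROUP-LIKE-TYPE case, with hypothesis (b) in its typed form `HypB`**: the full
conclusion of the typed statement `PreFrobenioidData.Thm34iii` for Frobenioids of quasi-isotropic and
group-like type. [cite: MochizukiFrdI2008, Thm. 3.4 (iii) p.62] -/
theorem thm34iii_of_isOfGroupLikeType_of_hypB (hF₁ : PreFrobenioid.IsFrobenioid F₁)
    (hF₂ : PreFrobenioid.IsFrobenioid F₂) (hq₁ : (PreFrobenioidData.ofFunctor Φ₁ F₁).IsOfQuasiIsotropicType)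
    (hq₂ : (PreFrobenioidData.ofFunctor Φ₂ F₂).IsOfQuasiIsotropicType)
    (hg₁ : (PreFrobenioidData.ofFunctor Φ₁ F₁).IsOfGroupLikeType)
    (hg₂ : (PreFrobenioidData.ofFunctor Φ₂ F₂).IsOfGroupLikeType) (Ψ : C₁ ≌ C₂)
    (hb : (PreFrobenioidData.ofFunctor Φ₁ F₁).HypB (PreFrobenioidData.ofFunctor Φ₂ F₂) Ψ) :
    (PreFrobenioidData.PreservesMor Ψ.functor (PreFrobenioidData.ofFunctor Φ₁ F₁).IsFrobeniusType
        (PreFrobenioidData.ofFunctor Φ₂ F₂).IsFrobeniusType ∧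
      PreFrobenioidData.PreservesMor Ψ.functor (PreFrobenioidData.ofFunctor Φ₁ F₁).IsLinear
        (PreFrobenioidData.ofFunctor Φ₂ F₂).IsLinear ∧
      PreFrobenioidData.PreservesMor Ψ.functor (PreFrobenioidData.ofFunctor Φ₁ F₁).IsBaseIso
        (PreFrobenioidData.ofFunctor Φ₂ F₂).IsBaseIso ∧
      PreFrobenioidData.PreservesMor Ψ.functor (PreFrobenioidData.ofFunctor Φ₁ F₁).IsCoAngular
        (PreFrobenioidData.ofFunctor Φ₂ F₂).IsCoAngular ∧
      PreFrobenioidData.PreservesMor Ψ.functor (PreFrobenioidData.ofFunctor Φ₁ F₁).IsPullbackMorphism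
        (PreFrobenioidData.ofFunctor Φ₂ F₂).IsPullbackMorphism ∧
      PreFrobenioidData.PreservesMor Ψ.functor (PreFrobenioidData.ofFunctor Φ₁ F₁).IsIsometry
        (PreFrobenioidData.ofFunctor Φ₂ F₂).IsIsometry ∧
      PreFrobenioidData.PreservesMor Ψ.functor (PreFrobenioidData.ofFunctor Φ₁ F₁).IsLBInvertible
        (PreFrobenioidData.ofFunctor Φ₂ F₂).IsLBInvertible) ∧
    ∃ ΨN : ℕ+ ≃* ℕ+, (∀ ⦃A B : C₁⦄ (φ : A ⟶ B),
        (PreFrobenioidData.ofFunctor Φ₂ F₂).degFr (Ψ.functor.map φ) =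
          ΨN ((PreFrobenioidData.ofFunctor Φ₁ F₁).degFr φ)) ∧
      ((∃ A : C₁, ¬ (PreFrobenioidData.ofFunctor Φ₁ F₁).IsGroupLikeObj A) →
        (∃ A : C₂, ¬ (PreFrobenioidData.ofFunctor Φ₂ F₂).IsGroupLikeObj A) → ΨN = MulEquiv.refl ℕ+) :=
  thm34iii_morphisms_of_isOfGroupLikeType hF₁ hF₂ hq₁ hq₂ hg₁ hg₂ Ψ (hb hg₁ hg₂).1 (hb hg₁ hg₂).2

/-- **Sub-DAG slot `FrdI:Thm3.4(iii)/L01g GroupLikeTypeCase`, literal shape of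
`FrdI.Thm34Sub.L01g_GroupLikeTypeCase`** (abc-iut-L1-d8's statements file `Thm34Sub.lean`): Frobenioids of
group-like and quasi-isotropic type over (FSM-type — accepted, unused) bases, `Ψ` and `Ψ⁻¹` preserving
base-isomorphisms ⟹ `Ψ` preserves morphisms of Frobenius type, linear, co-angular, pull-back morphisms,
isometries, LB-invertible morphisms, and `deg_Fr(Ψ φ) = Ψ^{ℕ≥1}(deg_Fr φ)` for an automorphism `Ψ^{ℕ≥1}`
of `ℕ≥1`. The slot's `_holds` is `FrdI.l01g_groupLikeTypeCase Ψ` (checked against the staged statement).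
[cite: MochizukiFrdI2008, Thm. 3.4 (iii) p.62] -/
theorem l01g_groupLikeTypeCase (Ψ : C₁ ≌ C₂) (hF₁ : PreFrobenioid.IsFrobenioid F₁)
    (hF₂ : PreFrobenioid.IsFrobenioid F₂) (hg₁ : (PreFrobenioidData.ofFunctor Φ₁ F₁).IsOfGroupLikeType)
    (hg₂ : (PreFrobenioidData.ofFunctor Φ₂ F₂).IsOfGroupLikeType)
    (hq₁ : (PreFrobenioidData.ofFunctor Φ₁ F₁).IsOfQuasiIsotropicType)
    (hq₂ : (PreFrobenioidData.ofFunctor Φ₂ F₂).IsOfQuasiIsotropicType)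
    (_hD₁ : IsOfFSMType D₁) (_hD₂ : IsOfFSMType D₂)
    (hB : PreFrobenioidData.PreservesMor Ψ.functor (PreFrobenioidData.ofFunctor Φ₁ F₁).IsBaseIso
      (PreFrobenioidData.ofFunctor Φ₂ F₂).IsBaseIso)
    (hB' : PreFrobenioidData.PreservesMor Ψ.inverse (PreFrobenioidData.ofFunctor Φ₂ F₂).IsBaseIso
      (PreFrobenioidData.ofFunctor Φ₁ F₁).IsBaseIso) :
    (PreFrobenioidData.PreservesMor Ψ.functor (PreFrobenioidData.ofFunctor Φ₁ F₁).IsFrobeniusType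
        (PreFrobenioidData.ofFunctor Φ₂ F₂).IsFrobeniusType ∧
      PreFrobenioidData.PreservesMor Ψ.functor (PreFrobenioidData.ofFunctor Φ₁ F₁).IsLinear
        (PreFrobenioidData.ofFunctor Φ₂ F₂).IsLinear ∧
      PreFrobenioidData.PreservesMor Ψ.functor (PreFrobenioidData.ofFunctor Φ₁ F₁).IsCoAngular
        (PreFrobenioidData.ofFunctor Φ₂ F₂).IsCoAngular ∧
      PreFrobenioidData.PreservesMor Ψ.functor (PreFrobenioidData.ofFunctor Φ₁ F₁).IsPullbackMorphism
        (PreFrobenioidData.ofFunctor Φ₂ F₂).IsPullbackMorphism ∧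
      PreFrobenioidData.PreservesMor Ψ.functor (PreFrobenioidData.ofFunctor Φ₁ F₁).IsIsometry
        (PreFrobenioidData.ofFunctor Φ₂ F₂).IsIsometry ∧
      PreFrobenioidData.PreservesMor Ψ.functor (PreFrobenioidData.ofFunctor Φ₁ F₁).IsLBInvertible
        (PreFrobenioidData.ofFunctor Φ₂ F₂).IsLBInvertible) ∧
    ∃ ΨN : ℕ+ ≃* ℕ+, ∀ ⦃A B : C₁⦄ (φ : A ⟶ B),
      (PreFrobenioidData.ofFunctor Φ₂ F₂).degFr (Ψ.functor.map φ) = ΨN ((PreFrobenioidData.ofFunctor Φ₁ F₁).degFr φ) := by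
  obtain ⟨⟨h1, h2, -, h4, h5, h6, h7⟩, ΨN, hΨN, -⟩ :=
    thm34iii_morphisms_of_isOfGroupLikeType hF₁ hF₂ hq₁ hq₂ hg₁ hg₂ Ψ hB hB'
  exact ⟨⟨h1, h2, h4, h5, h6, h7⟩, ΨN, hΨN⟩

end Two

end FrdI

end Literature.AlgebraicGeometry.Frobenioids
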